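import Summits.Ventures.CertifiedManyBodySolver.Downfold.PinnedPairTPrimeOfKernelCerts
import Summits.Ventures.CertifiedManyBodySolver.Downfold.BoxesLa214V115M2cBoxReadKernelWindowAF
import HarnessLib

/-!
# M2(c) «LSCO x = 1/8» — the LITERAL-FREE KERNEL-PAIR CLOSER of the leaf `La214M2c_StiffnessBoxCeiling` (tier-P endpoint)

Venture CertifiedManyBodySolver; cell `hubbard-obs` / D-0154 (1)(C) COVERAGE; seat `hubbard-cov-la214-box-2` (g2); captain hubbard-cov-la214-plan-1 g2 «GO D»
(hubbard-obs STATUS 2026-08-28T21:19:51Z), spec = hubbard-cov-la214-unc-3 g5's remark 2026-08-28T21:18:10Z (3). The M2(c) station plan (`U = 29/5`, `n₀ = 7/8`,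
slab `[171/200, 179/200]`) closes the leaf from TWO `t′`-bundle rows {`Po` on `[−357/740, −3/10]` with the corner word `P = −X₀(−3/10, 29/5)`, `Oi` on
`[−3/10, −1/5]` with the own word `s ↦ −X₀(s, 29/5)`} at the hypothesis-free K-AF kernel windows (`La214M2c_StiffnessBoxCeiling_of_twoBundleRowsWN_kinQ_kernelWindowAF`,
p648777). Each row is a theorem of a PINNED `t′`-PAIR node‴ (p663521 / p665068), and a pair node‴ is — since p669208 — the conclusion of TWO SYNTACTIC window
certificates sharing ONE equation-of-motion word list (`TPrimePinnedPair{Family,}RowWN.of_kernelCerts_sos`). THIS FILE composes the chain ONCE, literal-free: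

* `TPrimePinnedPairRowWN.refloor` / `TPrimePinnedPairFamilyRowWN.refloor` — the floor re-key identities (`fl_v ↦ fl_v″`, `β_v ↦ β_v − κ_v′(fl_v − fl_v″)`), public
  twins of the private lemmas of `Certificates/…_station29o5_pinnedPairs.lean` (the law files carry the cap re-key `reprice` only).
* **`La214M2c_StiffnessBoxCeiling_of_kernelPairs`** — DATA: shared letters / dictionaries / origin letters; the `Po` kernel pair {vertex `oA` at `t′ = −357/740`,
  vertex `oB` at `−3/10`; objective `P`; ONE shared `EBo`} and the `Oi` kernel pair {`iA` at `−3/10`, `iB` at `−1/5`; objectives `−X₀(−3/10)`, `−X₀(−1/5)`; ONE shared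
  `EBi`}, each vertex = hubbard-obs-p2's `residT` data + its collected normal form `R_v` + ONE decidable inequality `β_v ≤ lowerConst R_v + (μ_v 0 + μ_v 1)(7/16 − ν_v)`
  + the filling slope `sl_v = (μ_v 0 + μ_v 1)/2`; and ROW data `(F_o, L_o, F_i, L_i, c)` under DECIDABLE side conditions only — multipliers `κ ≥ 0`, the kernel
  cross constants `(16211390/10⁷)·(27/148)·(±Δκ_o) ≤ L_o`, `(16211390/10⁷)·(1/10)·(±Δκ_i) ≤ L_i`, the `Po` row INTERIOR kind (`0 < L_o`, `F_o ≤ β‴_oA − (L_o − (β‴_oB −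
  β‴_oA))²/(4L_o)`), the `Oi` row VERTEX kind, either end binding (`0 ≤ L_i ≤ |β‴_iB − β‴_iA|`, `F_i ≤ min β‴_iA β‴_iB`; hubbard-cov-la214-unc-3's symmetric form), where `β‴_v = β_v − κ_v(hi − cap_v) − κ_v′(fl_v + 3)` are the bounds
  re-keyed to the K-AF windows (`hi_o = −136960406889/2·10¹¹`, `hi_i = −2686934003/4·10⁹`, floor `−3`), the eight end prices `≤ c` and `4001658052/10¹⁰ ≤ c ≤
  4017332/10⁷` ⟹ `La214M2c_StiffnessBoxCeiling`. PROOF: `…of_kernelCerts_sos` ×2 (p669208) → `reprice` + `refloor` → `bundleWN_interior` (Po) / `bundleWN_vertex`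
  (Oi, chord `tPrimeObj_chord_negOddMomentTT`) (p662147 / p662965) → p648777's closer.

EFFECT: once an exporter emits the four vertex data sets (with the hub′/spoke pinning as literally shared `EBo` / `EBi`) and the four `normalize`/`lowerConst` facts are
evaluated in the kernel, the M2(c) leaf is a KERNEL theorem; until then the edition of record stays `…_cQ` (p660755) ⇐ the pair nodes‴ p663521 / p665068. Instantiated
here by NO certificate of record. NOT addressed: SU(2)-Ward rows (no `[S^±, ·]` slot; hubbard-obs-p2 SCOPE NOTE 2026-08-28T20:09:51Z).
HONEST FRAMING: conditional-closer plumbing for a CONTROL / CALIBRATION one-sided stiffness-scale box ceiling (wording (xx1)) at a doped station of a downfolded,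
screening-grade one-band box; no certificate evaluated, no node discharged, no number of record / tier / hold / box word changes; «closed modulo …» ≠ `proved`; a
ceiling never speaks to the presence of superconductivity or to `ρ_s = 0`; no `T_c` / phase sentence; nothing about La₁.₈₇₅Sr₀.₁₂₅CuO₄ samples; no item, rung leaf
(M2(c) has no route) or summit statement is proved here. Zero compute.

References: J. Wang et al., PRX 14 (2024) 031006, §III [cite: WangEtAl2024, §III]; C. Jansson, D. Chaykin, C. Keil, SIAM J. Numer. Anal. 46 (2008) 180, §3
[cite: JanssonChaykinKeil2008, §3]; S. Boyd, L. Vandenberghe, *Convex Optimization* (2004) §5.9 [cite: BoydVandenberghe2004, §5.9]; T. Koma, H. Tasaki,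
J. Stat. Phys. 76 (1994) 745, §1 [cite: KomaTasaki1994, §1].
-/

noncomputable section

namespace Summit.Ventures.CertifiedManyBodySolver.Downfold

open Literature.MathematicalPhysics.QuantumLattice Literature.MathematicalPhysics.QuantumLattice.ThermodynamicLimit
open Literature.MathematicalPhysics.QuantumLattice.InfVolFermionState
open Matrix HubbardWave0 Literature.Probability.LatticeModels Filter Topology
open Literature.MathematicalPhysics.QuantumManyBody.StateRelaxation
open Summit.Ventures.CertifiedQuantumChemistry Summit.Ventures.CertifiedQuantumChemistry.CARPoly
open Summit.Ventures.CertifiedManyBodySolver.CARPolyWindow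
open Summit.Ventures.CertifiedManyBodySolver.Observables
open scoped BigOperators ComplexOrder

/-! ## §0 Floor re-key identities (public twins) -/

section Refloor
variable {U sA sB : ℝ} {cA cB flA flB βA κA κA' slA βB κB κB' slB n₀ : ℚ}
  {X₀ : FermionOp (Literature.Probability.LatticeModels.box 2 7)} {X : ℝ → FermionOp (Literature.Probability.LatticeModels.box 2 7)}

/-- **FLOOR RE-KEY is an identity of the constant-objective pair**: `fl_v ↦ fl_v″`, `β_v ↦ β_v − κ_v′·(fl_v − fl_v″)`. [cite: BoydVandenberghe2004, §5.9] -/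
theorem TPrimePinnedPairRowWN.refloor
    (h : TPrimePinnedPairRowWN U sA sB cA cB flA flB βA κA κA' slA βB κB κB' slB n₀ X₀) (flA'' flB'' : ℚ) :
    TPrimePinnedPairRowWN U sA sB cA cB flA'' flB'' (βA - κA' * (flA - flA'')) κA κA' slA (βB - κB' * (flB - flB'')) κB κB' slB n₀ X₀ := by
  obtain ⟨E₀, E₁, hP⟩ := h
  refine ⟨E₀, E₁, fun s hs x hx0 hx2 ω Ls ψ hLs hψ h1 hω => ?_⟩
  obtain ⟨hE, hVA, hVB⟩ := hP s hs x hx0 hx2 ω Ls ψ hLs hψ h1 hω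
  refine ⟨hE, ?_, ?_⟩
  · have e : (((βA - κA' * (flA - flA'') : ℚ)) : ℝ) +
          ((κA' : ℚ) : ℝ) * (ω.meanEnergy (hubbardTTPrimeFermionInteraction 1 sA U) 1 - ((flA'' : ℚ) : ℝ)) =
        ((βA : ℚ) : ℝ) + ((κA' : ℚ) : ℝ) * (ω.meanEnergy (hubbardTTPrimeFermionInteraction 1 sA U) 1 - ((flA : ℚ) : ℝ)) := by
      push_cast; ring
    linarith
  · have e : (((βB - κB' * (flB - flB'') : ℚ)) : ℝ) +
          ((κB' : ℚ) : ℝ) * (ω.meanEnergy (hubbardTTPrimeFermionInteraction 1 sB U) 1 - ((flB'' : ℚ) : ℝ)) =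
        ((βB : ℚ) : ℝ) + ((κB' : ℚ) : ℝ) * (ω.meanEnergy (hubbardTTPrimeFermionInteraction 1 sB U) 1 - ((flB : ℚ) : ℝ)) := by
      push_cast; ring
    linarith

/-- **FLOOR RE-KEY is an identity of the objective-family pair.** [cite: BoydVandenberghe2004, §5.9] -/
theorem TPrimePinnedPairFamilyRowWN.refloor
    (h : TPrimePinnedPairFamilyRowWN U sA sB cA cB flA flB βA κA κA' slA βB κB κB' slB n₀ X) (flA'' flB'' : ℚ) :
    TPrimePinnedPairFamilyRowWN U sA sB cA cB flA'' flB'' (βA - κA' * (flA - flA'')) κA κA' slA (βB - κB' * (flB - flB'')) κB κB' slB n₀ X := by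
  obtain ⟨E₀, E₁, hP⟩ := h
  refine ⟨E₀, E₁, fun s hs x hx0 hx2 ω Ls ψ hLs hψ h1 hω => ?_⟩
  obtain ⟨hE, hVA, hVB⟩ := hP s hs x hx0 hx2 ω Ls ψ hLs hψ h1 hω
  refine ⟨hE, ?_, ?_⟩
  · have e : (((βA - κA' * (flA - flA'') : ℚ)) : ℝ) +
          ((κA' : ℚ) : ℝ) * (ω.meanEnergy (hubbardTTPrimeFermionInteraction 1 sA U) 1 - ((flA'' : ℚ) : ℝ)) =
        ((βA : ℚ) : ℝ) + ((κA' : ℚ) : ℝ) * (ω.meanEnergy (hubbardTTPrimeFermionInteraction 1 sA U) 1 - ((flA : ℚ) : ℝ)) := by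
      push_cast; ring
    linarith
  · have e : (((βB - κB' * (flB - flB'') : ℚ)) : ℝ) +
          ((κB' : ℚ) : ℝ) * (ω.meanEnergy (hubbardTTPrimeFermionInteraction 1 sB U) 1 - ((flB'' : ℚ) : ℝ)) =
        ((βB : ℚ) : ℝ) + ((κB' : ℚ) : ℝ) * (ω.meanEnergy (hubbardTTPrimeFermionInteraction 1 sB U) 1 - ((flB : ℚ) : ℝ)) := by
      push_cast; ring
    linarith

end Refloor

/-! ## §1 THE LITERAL-FREE KERNEL-PAIR CLOSER -/

section Closer

variable {α β : Type*} [LinearOrder α]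

/-- **`La214M2c_StiffnessBoxCeiling` ⇐ TWO KERNEL PAIRS (`Po`, `Oi`) + DECIDABLE ROW DATA.** See the module docstring for the data; every hypothesis below is either
exporter output (letters, term lists, the shared `EBo` / `EBi`), a `decide`/`native_decide`-class fact (`normalize … = R_v`, `β_v ≤ lowerConst R_v + …`) or a
`norm_num`-class rational side condition. Instantiated by NO certificate of record in this file. [cite: WangEtAl2024, §III] [cite: KomaTasaki1994, §1]
[cite: BoydVandenberghe2004, §5.9] -/
theorem La214M2c_StiffnessBoxCeiling_of_kernelPairs
    {Λ : Finset (Site 2)} (hΛ : Λ ⊆ Literature.Probability.LatticeModels.box 2 7) (h8 : thicken Λ 1 ⊆ Literature.Probability.LatticeModels.box 2 7)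
    (h0 : thicken ({0} : Finset (Site 2)) 1 ⊆ Literature.Probability.LatticeModels.box 2 7) (hz : (0 : Site 2) ∈ Literature.Probability.LatticeModels.box 2 7)
    -- letters (shared)
    (d : α → Orb (PolySite (Literature.Probability.LatticeModels.box 2 7))) (hd : Function.Injective d) (enc : α → ℕ) (Bkey : ℕ)
    (dΛ : β → Orb (PolySite Λ)) (f : β → α) (hf : ∀ b, d (f b) = Orb.embMap (PolySite.incl hΛ) (dΛ b))
    (sp : α → Fin 2) (hsp : ∀ a, (ofLex (d a)).2 = sp a)
    (o : Fin 2 → α) (ho : ∀ σ, d (o σ) = orb (PolySite.pt 0 hz) σ)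
    -- the `Po` pair: ONE shared eom word list
    (EBo : List (Terms β))
    -- vertex oA (t′ = (-(357 / 740) : ℚ))
    (THoA : Terms α)
    (hHoA : termOp d THoA = (hubbardTTPrimeFermionInteraction 1 (((-(357 / 740) : ℚ)) : ℝ) (((29 / 5 : ℚ)) : ℝ)).localHamiltonian (Literature.Probability.LatticeModels.box 2 7))
    (TEoA : Terms α)
    (hEoA : termOp d TEoA =
      fermionEmbed (PolySite.incl h0) ((hubbardTTPrimeFermionInteraction 1 (((-(357 / 740) : ℚ)) : ℝ) (((29 / 5 : ℚ)) : ℝ)).meanEnergyObs 1))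
    (TXoA : Terms α) (hXoA : termOp d TXoA = -oddMomentObsTT (-3 / 10) (29 / 5) 0)
    (μoA : Fin 2 → ℚ) (νoA κoA capoA κoA' floA : ℚ) (KoA : ℕ) (QoA : List (Terms α))
    {nSoA : ℕ} (γoA : Fin nSoA → DihedralGroup 4) (wvoA : Fin nSoA → Site 2)
    (hshoA : ∀ l, d4ShiftSet (γoA l) (wvoA l) Λ ⊆ Literature.Probability.LatticeModels.box 2 7) (goA : Fin nSoA → β → α)
    (hgoA : ∀ l b, d (goA l b) = Orb.embMap (PolySite.incl (hshoA l)) (Orb.embMap (PolySite.d4Emb (γoA l) (wvoA l) Λ) (dΛ b)))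
    (SYoA : Fin nSoA → Terms β) (CWoA : Terms α) (hcwoA : ∀ wc ∈ CWoA, chargeW wc.1 ≠ 0 ∨ spinChargeW sp wc.1 ≠ 0)
    (AVoA : List (Terms α)) {RoA : CARPoly.Poly α}
    (hRoA : CARPoly.normalize enc Bkey
      (residT TXoA μoA νoA o κoA capoA κoA' floA TEoA KoA QoA THoA f EBo goA SYoA CWoA AVoA) = RoA)
    {βoA : ℚ} (hβoA : βoA ≤ lowerConst RoA + (μoA 0 + μoA 1) * ((7 / 8 : ℚ) / 2 - νoA))
    {sloA : ℚ} (hsloA : sloA = (μoA 0 + μoA 1) / 2)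
    -- vertex oB (t′ = (-3 / 10 : ℚ))
    (THoB : Terms α)
    (hHoB : termOp d THoB = (hubbardTTPrimeFermionInteraction 1 (((-3 / 10 : ℚ)) : ℝ) (((29 / 5 : ℚ)) : ℝ)).localHamiltonian (Literature.Probability.LatticeModels.box 2 7))
    (TEoB : Terms α)
    (hEoB : termOp d TEoB =
      fermionEmbed (PolySite.incl h0) ((hubbardTTPrimeFermionInteraction 1 (((-3 / 10 : ℚ)) : ℝ) (((29 / 5 : ℚ)) : ℝ)).meanEnergyObs 1))
    (TXoB : Terms α) (hXoB : termOp d TXoB = -oddMomentObsTT (-3 / 10) (29 / 5) 0)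
    (μoB : Fin 2 → ℚ) (νoB κoB capoB κoB' floB : ℚ) (KoB : ℕ) (QoB : List (Terms α))
    {nSoB : ℕ} (γoB : Fin nSoB → DihedralGroup 4) (wvoB : Fin nSoB → Site 2)
    (hshoB : ∀ l, d4ShiftSet (γoB l) (wvoB l) Λ ⊆ Literature.Probability.LatticeModels.box 2 7) (goB : Fin nSoB → β → α)
    (hgoB : ∀ l b, d (goB l b) = Orb.embMap (PolySite.incl (hshoB l)) (Orb.embMap (PolySite.d4Emb (γoB l) (wvoB l) Λ) (dΛ b)))
    (SYoB : Fin nSoB → Terms β) (CWoB : Terms α) (hcwoB : ∀ wc ∈ CWoB, chargeW wc.1 ≠ 0 ∨ spinChargeW sp wc.1 ≠ 0)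
    (AVoB : List (Terms α)) {RoB : CARPoly.Poly α}
    (hRoB : CARPoly.normalize enc Bkey
      (residT TXoB μoB νoB o κoB capoB κoB' floB TEoB KoB QoB THoB f EBo goB SYoB CWoB AVoB) = RoB)
    {βoB : ℚ} (hβoB : βoB ≤ lowerConst RoB + (μoB 0 + μoB 1) * ((7 / 8 : ℚ) / 2 - νoB))
    {sloB : ℚ} (hsloB : sloB = (μoB 0 + μoB 1) / 2)
    -- the `Oi` pair: ONE shared eom word list
    (EBi : List (Terms β))
    -- vertex iA (t′ = (-3 / 10 : ℚ))
    (THiA : Terms α)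
    (hHiA : termOp d THiA = (hubbardTTPrimeFermionInteraction 1 (((-3 / 10 : ℚ)) : ℝ) (((29 / 5 : ℚ)) : ℝ)).localHamiltonian (Literature.Probability.LatticeModels.box 2 7))
    (TEiA : Terms α)
    (hEiA : termOp d TEiA =
      fermionEmbed (PolySite.incl h0) ((hubbardTTPrimeFermionInteraction 1 (((-3 / 10 : ℚ)) : ℝ) (((29 / 5 : ℚ)) : ℝ)).meanEnergyObs 1))
    (TXiA : Terms α) (hXiA : termOp d TXiA = -oddMomentObsTT (-3 / 10) (29 / 5) 0)
    (μiA : Fin 2 → ℚ) (νiA κiA capiA κiA' fliA : ℚ) (KiA : ℕ) (QiA : List (Terms α))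
    {nSiA : ℕ} (γiA : Fin nSiA → DihedralGroup 4) (wviA : Fin nSiA → Site 2)
    (hshiA : ∀ l, d4ShiftSet (γiA l) (wviA l) Λ ⊆ Literature.Probability.LatticeModels.box 2 7) (giA : Fin nSiA → β → α)
    (hgiA : ∀ l b, d (giA l b) = Orb.embMap (PolySite.incl (hshiA l)) (Orb.embMap (PolySite.d4Emb (γiA l) (wviA l) Λ) (dΛ b)))
    (SYiA : Fin nSiA → Terms β) (CWiA : Terms α) (hcwiA : ∀ wc ∈ CWiA, chargeW wc.1 ≠ 0 ∨ spinChargeW sp wc.1 ≠ 0)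
    (AViA : List (Terms α)) {RiA : CARPoly.Poly α}
    (hRiA : CARPoly.normalize enc Bkey
      (residT TXiA μiA νiA o κiA capiA κiA' fliA TEiA KiA QiA THiA f EBi giA SYiA CWiA AViA) = RiA)
    {βiA : ℚ} (hβiA : βiA ≤ lowerConst RiA + (μiA 0 + μiA 1) * ((7 / 8 : ℚ) / 2 - νiA))
    {sliA : ℚ} (hsliA : sliA = (μiA 0 + μiA 1) / 2)
    -- vertex iB (t′ = (-1 / 5 : ℚ))
    (THiB : Terms α)
    (hHiB : termOp d THiB = (hubbardTTPrimeFermionInteraction 1 (((-1 / 5 : ℚ)) : ℝ) (((29 / 5 : ℚ)) : ℝ)).localHamiltonian (Literature.Probability.LatticeModels.box 2 7))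
    (TEiB : Terms α)
    (hEiB : termOp d TEiB =
      fermionEmbed (PolySite.incl h0) ((hubbardTTPrimeFermionInteraction 1 (((-1 / 5 : ℚ)) : ℝ) (((29 / 5 : ℚ)) : ℝ)).meanEnergyObs 1))
    (TXiB : Terms α) (hXiB : termOp d TXiB = -oddMomentObsTT (-1 / 5) (29 / 5) 0)
    (μiB : Fin 2 → ℚ) (νiB κiB capiB κiB' fliB : ℚ) (KiB : ℕ) (QiB : List (Terms α))
    {nSiB : ℕ} (γiB : Fin nSiB → DihedralGroup 4) (wviB : Fin nSiB → Site 2)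
    (hshiB : ∀ l, d4ShiftSet (γiB l) (wviB l) Λ ⊆ Literature.Probability.LatticeModels.box 2 7) (giB : Fin nSiB → β → α)
    (hgiB : ∀ l b, d (giB l b) = Orb.embMap (PolySite.incl (hshiB l)) (Orb.embMap (PolySite.d4Emb (γiB l) (wviB l) Λ) (dΛ b)))
    (SYiB : Fin nSiB → Terms β) (CWiB : Terms α) (hcwiB : ∀ wc ∈ CWiB, chargeW wc.1 ≠ 0 ∨ spinChargeW sp wc.1 ≠ 0)
    (AViB : List (Terms α)) {RiB : CARPoly.Poly α}
    (hRiB : CARPoly.normalize enc Bkey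
      (residT TXiB μiB νiB o κiB capiB κiB' fliB TEiB KiB QiB THiB f EBi giB SYiB CWiB AViB) = RiB)
    {βiB : ℚ} (hβiB : βiB ≤ lowerConst RiB + (μiB 0 + μiB 1) * ((7 / 8 : ℚ) / 2 - νiB))
    {sliB : ℚ} (hsliB : sliB = (μiB 0 + μiB 1) / 2)
    -- row data and DECIDABLE side conditions
    (Fo Lo Fi Li c : ℚ)
    (hκoA : 0 ≤ κoA) (hκoA' : 0 ≤ κoA') (hκoB : 0 ≤ κoB) (hκoB' : 0 ≤ κoB')
    (hκiA : 0 ≤ κiA) (hκiA' : 0 ≤ κiA') (hκiB : 0 ≤ κiB) (hκiB' : 0 ≤ κiB')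
    (hLo₁ : (16211390 / 10000000 : ℚ) * (27 / 148) * (κoA - κoA' - (κoB - κoB')) ≤ Lo)
    (hLo₂ : (16211390 / 10000000 : ℚ) * (27 / 148) * -(κoA - κoA' - (κoB - κoB')) ≤ Lo) (hLo0 : 0 < Lo)
    (hFo : Fo ≤ (βoA - κoA * ((-136960406889 / 200000000000 : ℚ) - capoA) - κoA' * (floA - (-3))) -
      (Lo - ((βoB - κoB * ((-136960406889 / 200000000000 : ℚ) - capoB) - κoB' * (floB - (-3))) - (βoA - κoA * ((-136960406889 / 200000000000 : ℚ) - capoA) - κoA' * (floA - (-3))))) ^ 2 / (4 * Lo))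
    (hLi₁ : (16211390 / 10000000 : ℚ) * (1 / 10) * (κiA - κiA' - (κiB - κiB')) ≤ Li)
    (hLi₂ : (16211390 / 10000000 : ℚ) * (1 / 10) * -(κiA - κiA' - (κiB - κiB')) ≤ Li) (hLi0 : 0 ≤ Li)
    (hLi : Li ≤ |(βiB - κiB * ((-2686934003 / 4000000000 : ℚ) - capiB) - κiB' * (fliB - (-3))) - (βiA - κiA * ((-2686934003 / 4000000000 : ℚ) - capiA) - κiA' * (fliA - (-3)))|)
    (hFi : Fi ≤ min (βiA - κiA * ((-2686934003 / 4000000000 : ℚ) - capiA) - κiA' * (fliA - (-3))) (βiB - κiB * ((-2686934003 / 4000000000 : ℚ) - capiB) - κiB' * (fliB - (-3))))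
    (hbar : c ≤ 4017332 / 10000000) (hkin : (4001658052 / 10000000000 : ℚ) ≤ c)
    (pPo : -Fo - sloA * (171 / 200 - 7 / 8) ≤ c ∧ -Fo - sloA * (179 / 200 - 7 / 8) ≤ c ∧
      -Fo - sloB * (171 / 200 - 7 / 8) ≤ c ∧ -Fo - sloB * (179 / 200 - 7 / 8) ≤ c)
    (pOi : -Fi - sliA * (171 / 200 - 7 / 8) ≤ c ∧ -Fi - sliA * (179 / 200 - 7 / 8) ≤ c ∧
      -Fi - sliB * (171 / 200 - 7 / 8) ≤ c ∧ -Fi - sliB * (179 / 200 - 7 / 8) ≤ c) :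
    La214M2c_StiffnessBoxCeiling := by
  -- cast literals
  have eU : (((29 / 5 : ℚ)) : ℝ) = 29 / 5 := by norm_num
  have eo : (((-(357 / 740) : ℚ)) : ℝ) = -(357 / 740) := by norm_num
  have em : (((-3 / 10 : ℚ)) : ℝ) = -3 / 10 := by norm_num
  have ei : (((-1 / 5 : ℚ)) : ℝ) = -1 / 5 := by norm_num
  -- (1) the `Po` kernel pair ⇒ the constant-objective pair node‴
  have pairPo := TPrimePinnedPairRowWN.of_kernelCerts_sos (29 / 5) (by norm_num) (7 / 8) (-(357 / 740)) (-3 / 10) hΛ h8 h0 hz d hd enc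
    Bkey dΛ f hf sp hsp o ho (-oddMomentObsTT (-3 / 10) (29 / 5) 0) EBo
    THoA hHoA TEoA hEoA TXoA hXoA μoA νoA κoA capoA κoA' floA KoA QoA γoA wvoA hshoA goA hgoA SYoA CWoA hcwoA AVoA hRoA hβoA hsloA
    THoB hHoB TEoB hEoB TXoB hXoB μoB νoB κoB capoB κoB' floB KoB QoB γoB wvoB hshoB goB hgoB SYoB CWoB hcwoB AVoB hRoB hβoB hsloB
  rw [eU, eo, em] at pairPo
  -- (2) the `Oi` kernel pair ⇒ the objective-family pair node‴
  have hXiA' : termOp d TXiA = (fun s : ℝ => -oddMomentObsTT s (29 / 5) 0) (((-3 / 10 : ℚ)) : ℝ) := by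
    simp only [em]; exact hXiA
  have hXiB' : termOp d TXiB = (fun s : ℝ => -oddMomentObsTT s (29 / 5) 0) (((-1 / 5 : ℚ)) : ℝ) := by
    simp only [ei]; exact hXiB
  have pairOi := TPrimePinnedPairFamilyRowWN.of_kernelCerts_sos (29 / 5) (by norm_num) (7 / 8) (-3 / 10) (-1 / 5) hΛ h8 h0 hz d hd enc
    Bkey dΛ f hf sp hsp o ho (fun s : ℝ => -oddMomentObsTT s (29 / 5) 0) EBi
    THiA hHiA TEiA hEiA TXiA hXiA' μiA νiA κiA capiA κiA' fliA KiA QiA γiA wviA hshiA giA hgiA SYiA CWiA hcwiA AViA hRiA hβiA hsliA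
    THiB hHiB TEiB hEiB TXiB hXiB' μiB νiB κiB capiB κiB' fliB KiB QiB γiB wviB hshiB giB hgiB SYiB CWiB hcwiB AViB hRiB hβiB hsliB
  rw [eU, em, ei] at pairOi
  -- (3) the two bundle rows at the K-AF kernel windows (re-key, then the boxdual law: `Po` interior, `Oi` vertex)
  have hLo₁' : (1.6211390 : ℝ) * (-3 / 10 - -(357 / 740)) * (((κoA - κoA' - (κoB - κoB') : ℚ)) : ℝ) ≤ ((Lo : ℚ) : ℝ) := by
    have h := (Rat.cast_le (K := ℝ)).2 hLo₁
    have e : (1.6211390 : ℝ) * (-3 / 10 - -(357 / 740)) = (((16211390 / 10000000 : ℚ) * (27 / 148) : ℚ) : ℝ) := by norm_num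
    rw [e]; push_cast at h ⊢; linarith
  have hLo₂' : (1.6211390 : ℝ) * (-3 / 10 - -(357 / 740)) * -(((κoA - κoA' - (κoB - κoB') : ℚ)) : ℝ) ≤ ((Lo : ℚ) : ℝ) := by
    have h := (Rat.cast_le (K := ℝ)).2 hLo₂
    have e : (1.6211390 : ℝ) * (-3 / 10 - -(357 / 740)) = (((16211390 / 10000000 : ℚ) * (27 / 148) : ℚ) : ℝ) := by norm_num
    rw [e]; push_cast at h ⊢; linarith
  have hLi₁' : (1.6211390 : ℝ) * (-1 / 5 - -3 / 10) * (((κiA - κiA' - (κiB - κiB') : ℚ)) : ℝ) ≤ ((Li : ℚ) : ℝ) := by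
    have h := (Rat.cast_le (K := ℝ)).2 hLi₁
    have e : (1.6211390 : ℝ) * (-1 / 5 - -3 / 10) = (((16211390 / 10000000 : ℚ) * (1 / 10) : ℚ) : ℝ) := by norm_num
    rw [e]; push_cast at h ⊢; linarith
  have hLi₂' : (1.6211390 : ℝ) * (-1 / 5 - -3 / 10) * -(((κiA - κiA' - (κiB - κiB') : ℚ)) : ℝ) ≤ ((Li : ℚ) : ℝ) := by
    have h := (Rat.cast_le (K := ℝ)).2 hLi₂
    have e : (1.6211390 : ℝ) * (-1 / 5 - -3 / 10) = (((16211390 / 10000000 : ℚ) * (1 / 10) : ℚ) : ℝ) := by norm_num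
    rw [e]; push_cast at h ⊢; linarith
  have hPo : TPrimeBundleOrbitLowerRowWN (29 / 5) (-(357 / 740)) (-3 / 10) (-3) (-136960406889 / 200000000000 : ℚ) Fo sloA sloB (7 / 8)
      (fun _ => -oddMomentObsTT (-3 / 10) (29 / 5) 0) :=
    ((pairPo.reprice (-136960406889 / 200000000000 : ℚ) (-136960406889 / 200000000000 : ℚ)).refloor (-3) (-3)).bundleWN_interior
      (L := Lo) (by norm_num) (by norm_num) hκoA hκoA' hκoB hκoB' le_rfl le_rfl le_rfl le_rfl hLo₁' hLo₂' hLo0 hFo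
  have hOi : TPrimeBundleOrbitLowerRowWN (29 / 5) (-3 / 10) (-1 / 5) (-3) (-2686934003 / 4000000000 : ℚ) Fi sliA sliB (7 / 8)
      (fun s : ℝ => -oddMomentObsTT s (29 / 5) 0) :=
    ((pairOi.reprice (-2686934003 / 4000000000 : ℚ) (-2686934003 / 4000000000 : ℚ)).refloor (-3) (-3)).bundleWN
      (L := Li) (by norm_num) (by norm_num) hκiA hκiA' hκiB hκiB' le_rfl le_rfl le_rfl le_rfl hLi₁' hLi₂'
      (tPrimeObj_chord_negOddMomentTT (29 / 5) (-3 / 10) (-1 / 5)) (fun w hw => by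
        -- VERTEX kind, either end binding: `F ≤ min β‴`, `L ≤ |Δβ‴|` (`tPrimePair_vertexFloor_le`)
        have h1 : ((Fi : ℚ) : ℝ) ≤ min ((((βiA - κiA * ((-2686934003 / 4000000000 : ℚ) - capiA) - κiA' * (fliA - (-3))) : ℚ)) : ℝ) ((((βiB - κiB * ((-2686934003 / 4000000000 : ℚ) - capiB) - κiB' * (fliB - (-3))) : ℚ)) : ℝ) := by
          rw [← Rat.cast_min]; exact (Rat.cast_le (K := ℝ)).2 hFi
        have h2 : ((Li : ℚ) : ℝ) ≤ |((((βiB - κiB * ((-2686934003 / 4000000000 : ℚ) - capiB) - κiB' * (fliB - (-3))) : ℚ)) : ℝ) - ((((βiA - κiA * ((-2686934003 / 4000000000 : ℚ) - capiA) - κiA' * (fliA - (-3))) : ℚ)) : ℝ)| := by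
          rw [← Rat.cast_sub, ← Rat.cast_abs]; exact (Rat.cast_le (K := ℝ)).2 hLi
        exact h1.trans (tPrimePair_vertexFloor_le _ _ _ w (by exact_mod_cast hLi0) h2 hw.1 hw.2))
  -- (4) the leaf at the K-AF kernel windows
  exact La214M2c_StiffnessBoxCeiling_of_twoBundleRowsWN_kinQ_kernelWindowAF (-3) (-3) (-136960406889 / 200000000000 : ℚ) (-2686934003 / 4000000000 : ℚ) Fo sloA sloB Fi sliA sliB c
    hbar hkin le_rfl le_rfl le_rfl le_rfl hPo hOi pPo pOi

end Closer

end Summit.Ventures.CertifiedManyBodySolver.Downfold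

end
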